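import Summits.AtomisticToContinuum.HydrodynamicLimit.Theorems.StiffCollisionalRelaxationAprioriBoundsTruncationTools
import Summits.AtomisticToContinuum.HydrodynamicLimit.Theorems.StiffCollisionalRelaxationAprioriBoundsVelocityTailsOfGaussianVelocityTails
import Literature.Barriers.AtomisticToContinuum.HighMomentumCutoff
import HarnessLib

/-!
# The TIGHTNESS form of component (i) of the a-priori crux from Gaussian velocity tails in the mean
(line `Sketch`, crux `StiffCollisionalRelaxation.AprioriBounds` = `CollisionIsometryCLT.AprioriBoundsPreShock`,
stmt-AtomisticToContinuum-14827; lead prover `prover-line-stmt-AtomisticToContinuum-14827-c5-0`, cycle 6)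

Component (i) of the crux asks, for some rate `λ > 0` and some threshold `C` FIXED in `N`, that the
time-averaged empirical exponential velocity moment `∫₀ᵗ (N+1)⁻¹∑ᵢ e^{λ|vᵢ(s)|²} ds` exceed `C` with
probability `→ 0` ("in-probability form").  Reshape r7 of the line derives it from an EXPECTED Gaussian moment
along the flow (`stub_velocityTails`, = the body of the item `SpeedCapSurgery.GaussianVelocityTails`, stmt-9633)
plus a fixed-time concentration statement (`stub_velocityLLN`), and the landed witness
`AprioriBoundsNegative.expMoment_bounds_not_sufficient` shows that no expectation bound alone gives the
in-probability form.  This file isolates what expectation bounds DO give, with no concentration input at all: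
the **tightness form** of (i),

`∃ λ > 0 ∀ ε > 0 ∃ C ∃ N₀ ∀ N ≥ N₀:  P_N{ C < ∫₀ᵗ (N+1)⁻¹∑ᵢ e^{λ|vᵢ(s)|²} ds } ≤ ε`,

a common WEAKENING of the in-probability form (take the same `C` for every `ε`) and of the expectation form
(Markov), and the form in which the crux's consumers use (i) (an `ε`-good event on which the time average is
bounded by `C(ε)`).

* `measure_timeAvg_expMoment_gt_le` — Markov–Tonelli along one hard-sphere flow: if
  `E_P expVelocityMoment c (Φ_s ·) ≤ C` on `[0, t]` then `P{tC + L < ∫₀ᵗ (N+1)⁻¹∑ᵢ e^{c|vᵢ(s)|²} ds} ≤ tC/L`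
  for every `L > 0` (the landed `measure_timeAvg_gt_le_of_trunc` with trivial truncation `W = g = 0`, `K = 1`,
  applied to the observables divided by `L`).
* `partOneTight_of_tails` — the tails hypothesis of `stub_partOneOfTails` ALONE gives the tightness form with
  `λ := c`, `C(ε) := tC + tC/ε + 1`, for the local Gibbs laws of any continuous positive profiles, any
  `0 < σ ≤ 1/2`, any flow family.
* `partOneTight_of_velocityTails` — under the crux prefix: the text of `stub_velocityTails` implies the tightness
  form of (i) (`σ₀ := min σ₀' (1/2)`).
* `partOneTight_of_gaussianVelocityTails` — hence the route item `SpeedCapSurgery.GaussianVelocityTails`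
  (stmt-9633) alone implies the tightness form of (i) under the crux prefix (via the landed dock
  `stub_velocityTails_of_gaussianVelocityTails`, p123807).

No new definitions, no named facts; axioms `propext`, `Classical.choice`, `Quot.sound`.
-/

noncomputable section

open MeasureTheory Filter Set Topology
open scoped ENNReal

namespace Summit.AtomisticToContinuum.HydrodynamicLimit.Theorems.AdiabatCeiling

open Literature.MathematicalPhysics.KineticTheory Literature.Analysis.FluidPDE
open Literature.Barriers.AtomisticToContinuum (expVelocityMoment)

/-- **Markov–Tonelli along a hard-sphere flow for the exponential velocity moment.**  For a flow `Φ` of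
`N + 1` spheres, a probability law `P` carried by the good set, `0 ≤ c`, and `E_P expVelocityMoment c (Φ_s ·) ≤ C`
for `s ∈ [0, t]` (`0 < t`): for every `L > 0`,
`P{t·C + L < ∫₀ᵗ (N+1)⁻¹∑ᵢ e^{c|vᵢ(s)|²} ds} ≤ (C/L)·t`. -/
theorem measure_timeAvg_expMoment_gt_le {N : ℕ} {ε : ℝ}
    (Φ : HardSphereFlow (Torus.geometry (Fin 3)) ε (N + 1)) (P : Measure (Config (N + 1) (Fin 3) T3))
    [IsProbabilityMeasure P] (hP : P Φ.goodᶜ = 0) {t c : ℝ} (ht : 0 < t) (hc : 0 ≤ c) {C : ℝ≥0∞}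
    (hmom : ∀ s ∈ Icc 0 t, ∫⁻ z, expVelocityMoment c (Φ.flow s z) ∂P ≤ C) {L : ℝ} (hL : 0 < L) :
    P {z | t * C.toReal + L <
        ∫ s in Icc 0 t, ∫ y, Real.exp (c * ‖y.2‖ ^ 2) ∂(empiricalMeasure (Φ.flow s z))} ≤
      C / ENNReal.ofReal L * ENNReal.ofReal t := by
  -- the observable `G₀ = (N+1)⁻¹∑ᵢ e^{c|vᵢ|²}` and its scaled copy `G = G₀ / L`
  set G₀ : Config (N + 1) (Fin 3) T3 → ℝ :=
    fun w => ((N + 1 : ℕ) : ℝ)⁻¹ * ∑ i, Real.exp (c * ‖(w i).2‖ ^ 2) with hG₀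
  have hG₀m : Measurable G₀ :=
    measurable_const.mul (Finset.measurable_sum _ fun i _ =>
      ((measurable_pi_apply i).snd.norm.pow_const 2 |>.const_mul c).exp)
  have hG₀nn : ∀ w, 0 ≤ G₀ w := fun w =>
    mul_nonneg (by positivity) (Finset.sum_nonneg fun i _ => (Real.exp_pos _).le)
  have hMm : Measurable (fun w : Config (N + 1) (Fin 3) T3 => expVelocityMoment c w) :=
    hG₀m.ennreal_ofReal
  have hMeq : ∀ w : Config (N + 1) (Fin 3) T3, expVelocityMoment c w = ENNReal.ofReal (G₀ w) := fun w => rfl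
  have hGemp : ∀ w : Config (N + 1) (Fin 3) T3,
      ∫ y, Real.exp (c * ‖y.2‖ ^ 2) ∂(empiricalMeasure w) = G₀ w := fun w => by
    simp only [hG₀, integral_empiricalMeasure]
  -- the landed Markov–Tonelli bound with trivial truncation (`W = g = 0`, `K = 1`) for `G₀/L`, `M/L`, `C/L`
  have hmain := measure_timeAvg_gt_le_of_trunc Φ P inferInstance hP
    (G := fun w => G₀ w / L) (W := fun _ => 0) (M := fun w => expVelocityMoment c w / ENNReal.ofReal L)
    (hG₀m.div_const L) measurable_const (hMm.div_const _) (t := t) (K := 1) ht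
    (C := C / ENNReal.ofReal L)
    (fun _ => le_rfl) (fun _ => zero_le_one) (fun w => div_nonneg (hG₀nn w) hL.le)
    (fun w => by
      rw [sub_zero, ENNReal.ofReal_one, div_one, ENNReal.ofReal_div_of_pos hL, hMeq])
    (fun z hz => by
      refine ⟨Real.exp (c * (2 * configEnergy z)) / L, fun s => div_le_div_of_nonneg_right ?_ hL.le⟩
      have h := AprioriBoundsNegative.expAvg_le_exp_lam_energy (N := N) (lam := c) hc (Φ.flow s z)
      rw [Φ.configEnergy_flow hz s] at h
      exact h)
    (fun s hs => by
      have hm : Measurable fun z => expVelocityMoment c (Φ.flow s z) := hMm.comp (Φ.measurable_flow s)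
      simp only [div_eq_mul_inv]
      rw [lintegral_mul_const _ hm]
      exact mul_le_mul' (hmom s hs) le_rfl)
    (g := fun _ => 0) aemeasurable_const (fun _ => le_rfl) (fun _ => zero_le_one)
    (fun _ _ => ENNReal.toReal_nonneg)
  simp only [sub_self, abs_zero, ENNReal.ofReal_zero, lintegral_const, zero_mul, zero_add,
    ENNReal.ofReal_one, div_one] at hmain
  -- the two events coincide: `tC + L < ∫ G₀` iff `t(C/L) + 1 < ∫ G₀/L`
  have hCL : (C / ENNReal.ofReal L).toReal = C.toReal / L := by
    rw [ENNReal.toReal_div, ENNReal.toReal_ofReal hL.le]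
  refine (measure_mono fun z hz => ?_).trans hmain
  simp only [mem_setOf_eq, hGemp] at hz ⊢
  rw [integral_div, hCL, lt_div_iff₀ hL]
  calc (t * (C.toReal / L) + 1) * L = t * C.toReal + L := by field_simp
    _ < ∫ s in Icc 0 t, G₀ (Φ.flow s z) := hz

/-- **The tightness form of component (i) from Gaussian velocity tails in the mean** (no concentration
input): an expected Gaussian velocity moment at rate `c` along the flow, `E_{P_N} expVelocityMoment c (Φ_s ·) ≤ C`
uniformly in `N ≥ N₀` and `s ≤ t`, gives, for every `ε > 0`, the threshold `C(ε) = tC + tC/ε + 1` with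
`P_N{C(ε) < ∫₀ᵗ (N+1)⁻¹∑ᵢ e^{c|vᵢ(s)|²} ds} ≤ ε` for all `N ≥ N₀`.  For the local Gibbs laws of any continuous
profiles `a₀, θ₀ > 0`, `u₀`, any `0 < σ ≤ 1/2`, any family of hard-sphere flows. -/
theorem partOneTight_of_tails :
    ∀ (a₀ θ₀ : T3 → ℝ) (u₀ : T3 → V3), Continuous a₀ → Continuous θ₀ → Continuous u₀ →
      (∀ x, 0 < a₀ x) → (∀ x, 0 < θ₀ x) →
      ∀ (σ : ℝ), 0 < σ → σ ≤ 1 / 2 →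
      ∀ (Φ : (N : ℕ) → HardSphereFlow (Torus.geometry (Fin 3)) (hsDiameter σ N) (N + 1))
        (t c : ℝ) (C : ℝ≥0∞) (N₀ : ℕ), 0 < t → 0 < c → C < ⊤ →
        (∀ N : ℕ, N₀ ≤ N → ∀ s ∈ Icc 0 t,
          ∫⁻ z, Literature.Barriers.AtomisticToContinuum.expVelocityMoment c ((Φ N).flow s z)
            ∂(localGibbsLaw σ a₀ u₀ θ₀ N (Φ N)) ≤ C) →
        ∀ ε : ℝ, 0 < ε → ∃ Cexp : ℝ, ∀ N : ℕ, N₀ ≤ N →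
          localGibbsLaw σ a₀ u₀ θ₀ N (Φ N)
              {z | Cexp < ∫ s in Icc 0 t, ∫ y, Real.exp (c * ‖y.2‖ ^ 2)
                ∂(empiricalMeasure ((Φ N).flow s z))} ≤ ENNReal.ofReal ε := by
  intro a₀ θ₀ u₀ ha hθ hu ha0 hθ0 σ _hσ hσ2 Φ t c C N₀ ht hc hC htails ε hε
  haveI hprob : ∀ N, IsProbabilityMeasure (localGibbsLaw σ a₀ u₀ θ₀ N (Φ N)) := fun N =>
    isProbabilityMeasure_localGibbsLaw ha hθ hu ha0 hθ0 hσ2 N (Φ N)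
  have hgood0 : ∀ N, localGibbsLaw σ a₀ u₀ θ₀ N (Φ N) (Φ N).goodᶜ = 0 := fun N => by
    rw [localGibbsLaw_eq]
    exact (localGibbsMeasure_absolutelyContinuous σ _ _ _ N (Φ N)) (Φ N).measure_compl_good
  -- the Markov level `L` with `tC/L ≤ ε`
  set L : ℝ := C.toReal * t / ε + 1 with hLdef
  have hL : 0 < L := by positivity
  refine ⟨t * C.toReal + L, fun N hN => ?_⟩
  refine (measure_timeAvg_expMoment_gt_le (Φ N) (localGibbsLaw σ a₀ u₀ θ₀ N (Φ N)) (hgood0 N) ht hc.le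
    (fun s hs => htails N hN s hs) hL).trans ?_
  rw [← ENNReal.ofReal_toReal hC.ne, ← ENNReal.ofReal_div_of_pos hL, ← ENNReal.ofReal_mul (by positivity)]
  refine ENNReal.ofReal_le_ofReal ?_
  rw [div_mul_eq_mul_div, div_le_iff₀ hL]
  have hkey : C.toReal * t ≤ ε * (C.toReal * t / ε) := by
    rw [mul_div_cancel₀ _ hε.ne']
  calc C.toReal * t ≤ ε * (C.toReal * t / ε) := hkey
    _ ≤ ε * L := by
        refine mul_le_mul_of_nonneg_left ?_ hε.le
        rw [hLdef]
        linarith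

/-- **Under the crux prefix, the tails stub gives the tightness form of (i).**  From ANY producer of the text of
`stub_velocityTails` (hypothesis `h1`): for all continuous positive profiles `∃ σ₀ ∃ η₁ ∀ σ < σ₀`, for every
classical hs-Euler solution, flow family with the `t = 0` LLN, `0 < t < T` in the dilute chamber,
`∃ λ > 0 ∀ ε > 0 ∃ C ∃ N₀ ∀ N ≥ N₀`, `P_N{C < ∫₀ᵗ (N+1)⁻¹∑ᵢ e^{λ|vᵢ(s)|²} ds} ≤ ε`.  Thresholds
`σ₀ := min σ₀' (1/2)` (probability laws), `η₁` unchanged, `λ := c`. -/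
theorem partOneTight_of_velocityTails :
    (∀ (a₀ θ₀ : T3 → ℝ) (u₀ : T3 → V3), Continuous a₀ → Continuous θ₀ → Continuous u₀ →
        (∀ x, 0 < a₀ x) → (∀ x, 0 < θ₀ x) →
        ∃ σ₀ : ℝ, 0 < σ₀ ∧ ∃ η₁ : ℝ, 0 < η₁ ∧ ∀ σ : ℝ, 0 < σ → σ < σ₀ →
          ∀ (T : ℝ) (ρ θ : ℝ → T3 → ℝ) (u : ℝ → T3 → V3), IsHardSphereEulerSolution σ T ρ u θ →
          ∀ Φ : (N : ℕ) → HardSphereFlow (Torus.geometry (Fin 3)) (hsDiameter σ N) (N + 1),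
            TendstoHydroFieldsAt (fun N => localGibbsLaw σ a₀ u₀ θ₀ N (Φ N)) Φ ρ u θ 0 →
            ∀ t : ℝ, 0 < t → t < T → (∀ s ∈ Icc 0 t, ∀ x, 2 * ρ s x * σ ^ 3 < η₁) →
              ∃ c : ℝ, 0 < c ∧ ∃ C : ℝ≥0∞, C < ⊤ ∧ ∃ N₀ : ℕ, ∀ N : ℕ, N₀ ≤ N → ∀ s ∈ Icc 0 t,
                ∫⁻ z, Literature.Barriers.AtomisticToContinuum.expVelocityMoment c ((Φ N).flow s z)
                  ∂(localGibbsLaw σ a₀ u₀ θ₀ N (Φ N)) ≤ C) →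
    ∀ (a₀ θ₀ : T3 → ℝ) (u₀ : T3 → V3), Continuous a₀ → Continuous θ₀ → Continuous u₀ →
      (∀ x, 0 < a₀ x) → (∀ x, 0 < θ₀ x) →
      ∃ σ₀ : ℝ, 0 < σ₀ ∧ ∃ η₁ : ℝ, 0 < η₁ ∧ ∀ σ : ℝ, 0 < σ → σ < σ₀ →
        ∀ (T : ℝ) (ρ θ : ℝ → T3 → ℝ) (u : ℝ → T3 → V3), IsHardSphereEulerSolution σ T ρ u θ →
        ∀ Φ : (N : ℕ) → HardSphereFlow (Torus.geometry (Fin 3)) (hsDiameter σ N) (N + 1),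
          TendstoHydroFieldsAt (fun N => localGibbsLaw σ a₀ u₀ θ₀ N (Φ N)) Φ ρ u θ 0 →
          ∀ t : ℝ, 0 < t → t < T → (∀ s ∈ Icc 0 t, ∀ x, 2 * ρ s x * σ ^ 3 < η₁) →
            ∃ lam : ℝ, 0 < lam ∧ ∀ ε : ℝ, 0 < ε → ∃ Cexp : ℝ, ∃ N₀ : ℕ, ∀ N : ℕ, N₀ ≤ N →
              localGibbsLaw σ a₀ u₀ θ₀ N (Φ N)
                  {z | Cexp < ∫ s in Icc 0 t, ∫ y, Real.exp (lam * ‖y.2‖ ^ 2)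
                    ∂(empiricalMeasure ((Φ N).flow s z))} ≤ ENNReal.ofReal ε := by
  intro h1 a₀ θ₀ u₀ ha hθ hu ha0 hθ0
  obtain ⟨σ₁, hσ₁, η₁, hη₁, H1⟩ := h1 a₀ θ₀ u₀ ha hθ hu ha0 hθ0
  refine ⟨min σ₁ (1 / 2), lt_min hσ₁ one_half_pos, η₁, hη₁,
    fun σ hσ hσlt T ρ θ u hsol Φ hLLN t ht htT hdil => ?_⟩
  simp only [lt_min_iff] at hσlt
  obtain ⟨c, hc, C, hC, N₀, htails⟩ := H1 σ hσ hσlt.1 T ρ θ u hsol Φ hLLN t ht htT hdil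
  refine ⟨c, hc, fun ε hε => ?_⟩
  obtain ⟨Cexp, hCexp⟩ :=
    partOneTight_of_tails a₀ θ₀ u₀ ha hθ hu ha0 hθ0 σ hσ hσlt.2.le Φ t c C N₀ ht hc hC htails ε hε
  exact ⟨Cexp, N₀, hCexp⟩

/-- **The route item `SpeedCapSurgery.GaussianVelocityTails` (stmt-AtomisticToContinuum-9633) ALONE implies
the tightness form of component (i) under the crux prefix** (composition with the landed dock
`stub_velocityTails_of_gaussianVelocityTails`, p123807). -/
theorem partOneTight_of_gaussianVelocityTails
    (hGVT : Summit.AtomisticToContinuum.HydrodynamicLimit.Theses.SpeedCapSurgery.GaussianVelocityTails) :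
    ∀ (a₀ θ₀ : T3 → ℝ) (u₀ : T3 → V3), Continuous a₀ → Continuous θ₀ → Continuous u₀ →
      (∀ x, 0 < a₀ x) → (∀ x, 0 < θ₀ x) →
      ∃ σ₀ : ℝ, 0 < σ₀ ∧ ∃ η₁ : ℝ, 0 < η₁ ∧ ∀ σ : ℝ, 0 < σ → σ < σ₀ →
        ∀ (T : ℝ) (ρ θ : ℝ → T3 → ℝ) (u : ℝ → T3 → V3), IsHardSphereEulerSolution σ T ρ u θ →
        ∀ Φ : (N : ℕ) → HardSphereFlow (Torus.geometry (Fin 3)) (hsDiameter σ N) (N + 1),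
          TendstoHydroFieldsAt (fun N => localGibbsLaw σ a₀ u₀ θ₀ N (Φ N)) Φ ρ u θ 0 →
          ∀ t : ℝ, 0 < t → t < T → (∀ s ∈ Icc 0 t, ∀ x, 2 * ρ s x * σ ^ 3 < η₁) →
            ∃ lam : ℝ, 0 < lam ∧ ∀ ε : ℝ, 0 < ε → ∃ Cexp : ℝ, ∃ N₀ : ℕ, ∀ N : ℕ, N₀ ≤ N →
              localGibbsLaw σ a₀ u₀ θ₀ N (Φ N)
                  {z | Cexp < ∫ s in Icc 0 t, ∫ y, Real.exp (lam * ‖y.2‖ ^ 2)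
                    ∂(empiricalMeasure ((Φ N).flow s z))} ≤ ENNReal.ofReal ε :=
  partOneTight_of_velocityTails (stub_velocityTails_of_gaussianVelocityTails hGVT)

/-- The same from the barrier catalogue's open hypothesis `HighMomentumCutoff σ` for all small `σ`
(Nachtergaele–Yau II.1), via the landed `velocityTails_of_highMomentumCutoff`. -/
theorem partOneTight_of_highMomentumCutoff
    (hHMC : ∃ σ₀ : ℝ, 0 < σ₀ ∧ ∀ σ : ℝ, 0 < σ → σ < σ₀ →
      Literature.Barriers.AtomisticToContinuum.HighMomentumCutoff σ) :
    ∀ (a₀ θ₀ : T3 → ℝ) (u₀ : T3 → V3), Continuous a₀ → Continuous θ₀ → Continuous u₀ →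
      (∀ x, 0 < a₀ x) → (∀ x, 0 < θ₀ x) →
      ∃ σ₀ : ℝ, 0 < σ₀ ∧ ∃ η₁ : ℝ, 0 < η₁ ∧ ∀ σ : ℝ, 0 < σ → σ < σ₀ →
        ∀ (T : ℝ) (ρ θ : ℝ → T3 → ℝ) (u : ℝ → T3 → V3), IsHardSphereEulerSolution σ T ρ u θ →
        ∀ Φ : (N : ℕ) → HardSphereFlow (Torus.geometry (Fin 3)) (hsDiameter σ N) (N + 1),
          TendstoHydroFieldsAt (fun N => localGibbsLaw σ a₀ u₀ θ₀ N (Φ N)) Φ ρ u θ 0 →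
          ∀ t : ℝ, 0 < t → t < T → (∀ s ∈ Icc 0 t, ∀ x, 2 * ρ s x * σ ^ 3 < η₁) →
            ∃ lam : ℝ, 0 < lam ∧ ∀ ε : ℝ, 0 < ε → ∃ Cexp : ℝ, ∃ N₀ : ℕ, ∀ N : ℕ, N₀ ≤ N →
              localGibbsLaw σ a₀ u₀ θ₀ N (Φ N)
                  {z | Cexp < ∫ s in Icc 0 t, ∫ y, Real.exp (lam * ‖y.2‖ ^ 2)
                    ∂(empiricalMeasure ((Φ N).flow s z))} ≤ ENNReal.ofReal ε :=
  partOneTight_of_velocityTails (velocityTails_of_highMomentumCutoff hHMC)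

end Summit.AtomisticToContinuum.HydrodynamicLimit.Theorems.AdiabatCeiling
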